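import Mathlib.Analysis.SpecialFunctions.Trigonometric.Deriv
import Literature.Geometry.Lorentzian.KerrPhotonOrbitChristoffel
import Literature.Geometry.Lorentzian.OpensChartGeodesic
import Literature.Geometry.Lorentzian.KerrGaussianBeams
import HarnessLib

/-!
# The equatorial circular photon orbits of Kerr are null geodesics: discharge of
# `Sbierski2015_kerr_trappedNullGeodesic`
(family `gr`; namespace `Literature.Geometry.Lorentzian.Kerr`)

For `0 < M`, `0 ≤ a ≤ M`, with `r₀ ∈ [3M, 4M]` the retrograde photon radius
(`Kerr.exists_photonRadius`, `r₀(r₀ − 3M)² = 4a²M`), `q = √(M/r₀³)`, `ρ = √(r₀² + a²)`,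
`e = 1 − aq`, the explicit curve `c(s) = (e s, ρ cos(q s), −ρ sin(q s), 0)` of the ingoing
Kerr–Schild Cartesian chart (`Kerr.orbitCurve`) has constant Kerr–Schild radius `r₀ > r₊`,
velocity `Kerr.orbitVel` and acceleration `Kerr.orbitAcc` along itself, and this file **proves**
that it is a geodesic of the Levi-Civita connection of `Kerr.smoothMetric M a r₊` in the sense of
`Geodesic.lean` (`OpensChart.isGeodesic_of_hasDerivAt` with the pointwise geodesic equation
`Kerr.christoffel_orbitVel` of `KerrPhotonOrbitChristoffel.lean`), with null velocity
(`Kerr.bilin_orbitVel_self`: `g(c', c') = −e² + q²ρ² + 2M/r₀ = 0` by the orbit relation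
`2aq r₀ = r₀ − 3M`, `Kerr.orbit_relation`) whose `t*`-component is the constant `e ∈ (0, 1]`
(`Kerr.exists_trappedNullGeodesic`). This discharges the named fact
`Sbierski2015_kerr_trappedNullGeodesic` of `KerrGaussianBeams.lean` (Sbierski, Anal. PDE 8 (2015),
§7A: trapped null geodesics of Kerr with `N`-energy bounded away from `0` and `∞`):
`Sbierski2015_kerr_trappedNullGeodesic_holds`.

## References

* J. M. Bardeen, W. H. Press, S. A. Teukolsky, ApJ 178 (1972) 347, (2.18) (circular photon
  orbits `r_ph = 2M{1 + cos[⅔ arccos(∓a/M)]}`); S. Chandrasekhar, *The mathematical theory of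
  black holes*, 1983, §63(c).
* J. Sbierski, Anal. PDE 8 (2015) 1379–1420, §7A (key `Sbierski2015`).
* B. O'Neill, *The geometry of Kerr black holes*, 1995, Ch. 4 (key `ONeill1995`); B. O'Neill,
  *Semi-Riemannian geometry*, 1983, Ch. 3, Cor. 21 (key `ONeill1983`).
-/

noncomputable section

open Set Filter
open scoped Topology Manifold ContDiff

namespace Literature.Geometry.Lorentzian

namespace Kerr

/-! ### The orbit as a curve, and the discharge of the named fact -/

section Orbit

variable {M a r₀ q : ℝ}

/-- **The retrograde equatorial circular photon orbit in ingoing Kerr–Schild Cartesian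
coordinates**: `c(s) = ((1 − aq) s, ρ cos(q s), −ρ sin(q s), 0)`, `ρ = √(r₀² + a²)` (so that
circles of Kerr–Schild radius `r₀` traversed with angular frequency `−q`,
`q = √(M/r₀³)`, and `ṫ* = e = 1 − aq`). Bardeen–Press–Teukolsky 1972; Sbierski 2015, §7A.
[cite: Sbierski2015, §7A] -/
def orbitCurve (a r₀ q : ℝ) (s : ℝ) : E4 :=
  ((1 - a * q) * s) • E4.basisVector 0 + (√(r₀ ^ 2 + a ^ 2) * Real.cos (q * s)) • E4.basisVector 1 +
    (-(√(r₀ ^ 2 + a ^ 2) * Real.sin (q * s))) • E4.basisVector 2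

/-- The `t*`-component of the orbit curve. [folklore] -/
@[simp] theorem orbitCurve_apply_zero (s : ℝ) : orbitCurve a r₀ q s 0 = (1 - a * q) * s := by
  simp [orbitCurve]

/-- The `x`-component of the orbit curve. [folklore] -/
@[simp] theorem orbitCurve_apply_one (s : ℝ) :
    orbitCurve a r₀ q s 1 = √(r₀ ^ 2 + a ^ 2) * Real.cos (q * s) := by
  simp [orbitCurve]

/-- The `y`-component of the orbit curve. [folklore] -/
@[simp] theorem orbitCurve_apply_two (s : ℝ) :
    orbitCurve a r₀ q s 2 = -(√(r₀ ^ 2 + a ^ 2) * Real.sin (q * s)) := by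
  simp [orbitCurve]

/-- The `z`-component of the orbit curve. [folklore] -/
@[simp] theorem orbitCurve_apply_three (s : ℝ) : orbitCurve a r₀ q s 3 = 0 := by
  simp [orbitCurve]

/-- The orbit lies on the circle `x² + y² = r₀² + a²` of the hyperplane `{z = 0}`. [folklore] -/
theorem orbitCurve_circle (s : ℝ) :
    orbitCurve a r₀ q s 1 ^ 2 + orbitCurve a r₀ q s 2 ^ 2 = r₀ ^ 2 + a ^ 2 := by
  rw [orbitCurve_apply_one, orbitCurve_apply_two]
  have hρ : √(r₀ ^ 2 + a ^ 2) ^ 2 = r₀ ^ 2 + a ^ 2 := Real.sq_sqrt (by positivity)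
  nlinarith [Real.cos_sq_add_sin_sq (q * s)]

/-- The orbit has constant Kerr–Schild radius `r₀`. Sbierski 2015, §7A ("trapped on the
hypersurface `{r = r₀}`"). [cite: Sbierski2015, §7A] -/
theorem radius_orbitCurve (hr₀ : 0 < r₀) (s : ℝ) : radius a (orbitCurve a r₀ q s) = r₀ :=
  radius_of_circle hr₀ (orbitCurve_apply_three s) (orbitCurve_circle s)

/-- The velocity of the orbit is the field `orbitVel` along it. [folklore] -/
theorem hasDerivAt_orbitCurve (s : ℝ) :
    HasDerivAt (orbitCurve a r₀ q) (orbitVel a q (orbitCurve a r₀ q s)) s := by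
  have h0 : HasDerivAt (fun s : ℝ ↦ (1 - a * q) * s) (1 - a * q) s := by
    simpa using (hasDerivAt_id s).const_mul (1 - a * q)
  have hqs : HasDerivAt (fun s : ℝ ↦ q * s) q s := by simpa using (hasDerivAt_id s).const_mul q
  have h1 : HasDerivAt (fun s : ℝ ↦ √(r₀ ^ 2 + a ^ 2) * Real.cos (q * s))
      (√(r₀ ^ 2 + a ^ 2) * (-Real.sin (q * s) * q)) s :=
    ((Real.hasDerivAt_cos (q * s)).comp s hqs).const_mul _
  have h2 : HasDerivAt (fun s : ℝ ↦ -(√(r₀ ^ 2 + a ^ 2) * Real.sin (q * s)))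
      (-(√(r₀ ^ 2 + a ^ 2) * (Real.cos (q * s) * q))) s :=
    (((Real.hasDerivAt_sin (q * s)).comp s hqs).const_mul _).neg
  have h := ((h0.smul_const (E4.basisVector 0)).add (h1.smul_const (E4.basisVector 1))).add
    (h2.smul_const (E4.basisVector 2))
  refine h.congr_deriv ?_
  ext μ
  fin_cases μ <;> simp [orbitVel] <;> ring

/-- The acceleration of the orbit is the field `orbitAcc` along it. [folklore] -/
theorem hasDerivAt_orbitVel_orbitCurve (s : ℝ) :
    HasDerivAt (fun s ↦ orbitVel a q (orbitCurve a r₀ q s))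
      (orbitAcc q (orbitCurve a r₀ q s)) s := by
  have hqs : HasDerivAt (fun s : ℝ ↦ q * s) q s := by simpa using (hasDerivAt_id s).const_mul q
  have h1 : HasDerivAt (fun s : ℝ ↦ q * -(√(r₀ ^ 2 + a ^ 2) * Real.sin (q * s)))
      (q * -(√(r₀ ^ 2 + a ^ 2) * (Real.cos (q * s) * q))) s :=
    (((Real.hasDerivAt_sin (q * s)).comp s hqs).const_mul _).neg.const_mul q
  have h2 : HasDerivAt (fun s : ℝ ↦ -(q * (√(r₀ ^ 2 + a ^ 2) * Real.cos (q * s))))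
      (-(q * (√(r₀ ^ 2 + a ^ 2) * (-Real.sin (q * s) * q)))) s :=
    (((Real.hasDerivAt_cos (q * s)).comp s hqs).const_mul _).const_mul q |>.neg
  have h := (((hasDerivAt_const s (1 - a * q)).smul_const (E4.basisVector 0)).add
    (h1.smul_const (E4.basisVector 1))).add (h2.smul_const (E4.basisVector 2))
  have hfun : (fun s ↦ orbitVel a q (orbitCurve a r₀ q s)) = fun s ↦
      (1 - a * q) • E4.basisVector 0 + (q * -(√(r₀ ^ 2 + a ^ 2) * Real.sin (q * s))) •
        E4.basisVector 1 + (-(q * (√(r₀ ^ 2 + a ^ 2) * Real.cos (q * s)))) • E4.basisVector 2 := by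
    funext s
    simp only [orbitVel, orbitCurve_apply_one, orbitCurve_apply_two]
  rw [hfun]
  refine h.congr_deriv ?_
  ext μ
  fin_cases μ <;> simp [orbitAcc] <;> ring

/-- **The orbit relation** `2 a q r₀ = r₀ − 3M` from `r₀(r₀ − 3M)² = 4a²M`, `q² r₀³ = M`, `3M ≤ r₀`,
`0 ≤ a` (both sides are the nonnegative square roots of `4a²M/r₀`). Sbierski 2015, §7A
(`r_ρ` a root of `r(r − 3m)² − 4a²m`). [cite: Sbierski2015, §7A] -/
theorem orbit_relation (hM : 0 < M) (ha : 0 ≤ a) (h3 : 3 * M ≤ r₀) (hq0 : 0 ≤ q)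
    (hq : q ^ 2 * r₀ ^ 3 = M) (hcubic : r₀ * (r₀ - 3 * M) ^ 2 = 4 * a ^ 2 * M) :
    2 * a * q * r₀ = r₀ - 3 * M := by
  have hr₀ : 0 < r₀ := by linarith
  have h1 : r₀ * (r₀ - 3 * M) ^ 2 = r₀ * (2 * a * q * r₀) ^ 2 := by
    rw [hcubic, ← hq]; ring
  have h2 : (r₀ - 3 * M) ^ 2 = (2 * a * q * r₀) ^ 2 := mul_left_cancel₀ hr₀.ne' h1
  have hnn : 0 ≤ 2 * a * q * r₀ := by positivity
  rcases eq_or_eq_neg_of_sq_eq_sq _ _ h2 with h | h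
  · exact h.symm
  · linarith

/-- **The velocity of the photon orbit is null**: `g(c', c') = −e² + q²ρ² + 2(M/r₀)·1² = 0`
(`ℓ(c') = e + aq = 1`), by the orbit relation. Sbierski 2015, §7A. [cite: Sbierski2015, §7A] -/
theorem bilin_orbitVel_self (hM : 0 < M) (ha : 0 ≤ a) (h3 : 3 * M ≤ r₀) (hq0 : 0 ≤ q)
    (hq : q ^ 2 * r₀ ^ 3 = M) (hcubic : r₀ * (r₀ - 3 * M) ^ 2 = 4 * a ^ 2 * M) (s : ℝ) :
    bilin M a (orbitCurve a r₀ q s) (orbitVel a q (orbitCurve a r₀ q s))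
      (orbitVel a q (orbitCurve a r₀ q s)) = 0 := by
  have hr₀ : 0 < r₀ := by linarith
  set p := orbitCurve a r₀ q s with hp_def
  have hp3 : p 3 = 0 := orbitCurve_apply_three s
  have hcirc : p 1 ^ 2 + p 2 ^ 2 = r₀ ^ 2 + a ^ 2 := orbitCurve_circle s
  have ha' : a ^ 2 < p 1 ^ 2 + p 2 ^ 2 := by rw [hcirc]; nlinarith
  have hD : p 1 ^ 2 + p 2 ^ 2 ≠ 0 := ((sq_nonneg a).trans_lt ha').ne'
  have hrel := orbit_relation hM ha h3 hq0 hq hcubic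
  have hrad : radius a p = r₀ := radius_of_circle hr₀ hp3 hcirc
  have hL : nullCovector a p (orbitVel a q p) = 1 := by
    rw [nullCovector_apply_of_apply_three_eq_zero hp3 ha', hrad, orbitVel_apply_zero,
      orbitVel_apply_one, orbitVel_apply_two]
    field_simp
    ring
  have hH : scalarH M a p = M / r₀ := by
    rw [scalarH_of_apply_three_eq_zero M hp3 (by rw [hrad]; exact hr₀), hrad]
  have hη : Minkowski.bilin (orbitVel a q p) (orbitVel a q p) =
      -(1 - a * q) ^ 2 + q ^ 2 * (r₀ ^ 2 + a ^ 2) := by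
    simp only [Minkowski.bilin_apply, Fin.sum_univ_three, Fin.succ_zero_eq_one, Fin.succ_one_eq_two,
      Fin.reduceSucc, orbitVel_apply_zero, orbitVel_apply_one, orbitVel_apply_two,
      orbitVel_apply_three, ← hcirc]
    ring
  rw [bilin_apply, hL, hH, hη]
  field_simp
  linear_combination hrel + hq

/-- **The trapped null geodesic of Kerr with `N`-energy bounded away from `0` and `∞`**
(existence, all clauses of the named fact `Sbierski2015_kerr_trappedNullGeodesic`): for `0 < M`,
`0 ≤ a ≤ M` the photon orbit `Kerr.orbitCurve a r₀ q`, `r₀ ∈ [3M, 4M]` the retrograde photon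
radius, `q = √(M/r₀³)`, is a geodesic of the Levi-Civita connection of `Kerr.smoothMetric M a r₊`
with null velocity `(1 − aq) ∂_t + q y ∂_x − q x ∂_y`, of constant radius `r₀ > r₊`, with
`ṫ* = 1 − aq ∈ (0, 1]`. Sbierski 2015, §7A; O'Neill 1995, Ch. 4. [cite: Sbierski2015, §7A] -/
theorem exists_trappedNullGeodesic [Facts] [SliceFacts] (hM : 0 < M) (ha0 : 0 ≤ a) (haM : a ≤ M) :
    ∃ (r₀ e₁ e₂ : ℝ) (γ : ℝ → Kerr.exterior M a),
      Kerr.rPlus M a < r₀ ∧ r₀ * (r₀ - 3 * M) ^ 2 ≤ 4 * a ^ 2 * M ∧ 0 < e₁ ∧ e₁ ≤ e₂ ∧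
      IsGeodesic (Kerr.smoothMetric M a (Kerr.rPlus M a)).leviCivita γ ∧
      (∀ s, (Kerr.smoothMetric M a (Kerr.rPlus M a)).IsNull (velocity 𝓘(ℝ, E4) γ s)) ∧
      (∀ s, Kerr.radius a (γ s : E4) = r₀) ∧
      (γ 0 : E4) 0 = 0 ∧
      (∀ s, e₁ ≤ E4.time (velocity 𝓘(ℝ, E4) γ s) ∧ E4.time (velocity 𝓘(ℝ, E4) γ s) ≤ e₂) ∧
      Continuous (fun s ↦ (γ s : E4) 0) ∧
      StrictMono (fun s ↦ (γ s : E4) 0) ∧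
      Tendsto (fun s ↦ (γ s : E4) 0) atTop atTop := by
  obtain ⟨r₀, h3M, -, hcubic⟩ := exists_photonRadius hM (by nlinarith : a ^ 2 ≤ M ^ 2)
  have hr₀ : 0 < r₀ := by linarith
  set q := √(M / r₀ ^ 3) with hq_def
  have hq0 : 0 ≤ q := Real.sqrt_nonneg _
  have hq2 : q ^ 2 = M / r₀ ^ 3 := Real.sq_sqrt (by positivity)
  have hq : q ^ 2 * r₀ ^ 3 = M := by rw [hq2]; field_simp
  -- `e = 1 - a q > 0`
  have haq : a * q < 1 := by
    have h1 : (a * q) ^ 2 * r₀ ^ 3 = a ^ 2 * M := by rw [mul_pow, mul_assoc, hq]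
    have h2 : (3 * M) ^ 3 ≤ r₀ ^ 3 := pow_le_pow_left₀ (by linarith) h3M 3
    have h3 : a ^ 2 * M ≤ M ^ 2 * M :=
      mul_le_mul_of_nonneg_right (pow_le_pow_left₀ ha0 haM 2) hM.le
    have h4 : (a * q) ^ 2 * r₀ ^ 3 < 1 * r₀ ^ 3 := by nlinarith [pow_pos hM 3]
    have h5 : (a * q) ^ 2 < 1 := lt_of_mul_lt_mul_right h4 (pow_pos hr₀ 3).le
    nlinarith [mul_nonneg ha0 hq0]
  have he : 0 < 1 - a * q := by linarith
  -- the curve stays in the exterior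
  have hrp : Kerr.rPlus M a < r₀ := (rPlus_le_two_mul hM.le).trans_lt (by linarith)
  have hmem : ∀ s, orbitCurve a r₀ q s ∈ region a (rPlus M a) := fun s ↦ by
    rw [mem_region, radius_orbitCurve hr₀]
    exact max_lt hrp hr₀
  set γ : ℝ → Kerr.exterior M a := fun s ↦ ⟨orbitCurve a r₀ q s, hmem s⟩ with hγ_def
  -- geodesic and velocity, by the chart criterion
  obtain ⟨hgeo, hvel⟩ := OpensChart.isGeodesic_of_hasDerivAt
    (g := (smoothMetric M a (rPlus M a)).toPseudoRiemannianMetric) (G := bilin M a) (γ := γ)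
    (c := orbitCurve a r₀ q) (c' := fun s ↦ orbitVel a q (orbitCurve a r₀ q s))
    (c'' := fun s ↦ orbitAcc q (orbitCurve a r₀ q s)) (fun _ ↦ rfl)
    (fun y ↦ differentiableAt_bilin M a y) (fun _ ↦ rfl) hasDerivAt_orbitCurve
    hasDerivAt_orbitVel_orbitCurve
    (fun t ↦ christoffel_orbitVel hr₀ hq (hmem t) (orbitCurve_apply_three t) (orbitCurve_circle t))
  have hvel' : ∀ s, velocity 𝓘(ℝ, E4) (M := Kerr.exterior M a) γ s =
      orbitVel a q (orbitCurve a r₀ q s) := hvel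
  have hγ0 : ∀ s, (γ s : E4) 0 = (1 - a * q) * s := fun s ↦ orbitCurve_apply_zero s
  refine ⟨r₀, 1 - a * q, 1 - a * q, γ, hrp, hcubic.le, he, le_rfl, hgeo, fun s ↦ ?_,
    fun s ↦ radius_orbitCurve hr₀ s, by rw [hγ0]; ring, fun s ↦ ?_, ?_, ?_, ?_⟩
  · -- null velocity
    refine ⟨?_, fun h0 ↦ ?_⟩
    · rw [hvel' s]
      exact bilin_orbitVel_self hM ha0 h3M hq0 hq hcubic s
    · have h0' : (orbitVel a q (orbitCurve a r₀ q s) : E4) = (0 : E4) := (hvel' s).symm.trans h0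
      have h1 := congrArg (fun v : E4 ↦ v 0) h0'
      simp only [orbitVel_apply_zero, PiLp.zero_apply] at h1
      linarith
  · rw [hvel' s, E4.time_apply, orbitVel_apply_zero]
    exact ⟨le_rfl, le_rfl⟩
  · simp only [hγ0]; fun_prop
  · simp only [hγ0]; exact strictMono_id.const_mul he
  · simp only [hγ0]; exact Tendsto.const_mul_atTop he tendsto_id

end Orbit

end Kerr

/-- **Discharge of `Sbierski2015_kerr_trappedNullGeodesic`** (Sbierski, Anal. PDE 8 (2015), §7A:
"there are trapped null geodesics in the domain of outer communications of the Kerr spacetime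
whose energy stays bounded away from zero and infinity"): the retrograde equatorial circular
photon orbit, `Kerr.exists_trappedNullGeodesic`. [cite: Sbierski2015, §7A] -/
theorem Sbierski2015_kerr_trappedNullGeodesic_holds : Sbierski2015_kerr_trappedNullGeodesic := by
  intro _ _ M a hM ha0 haM
  exact Kerr.exists_trappedNullGeodesic hM ha0 haM

end Literature.Geometry.Lorentzian

end
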